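import Literature.Probability.Percolation.TriBoxCrossingLowerBound
import Literature.Probability.Percolation.TriHalfAnnulus
import Literature.Probability.Percolation.BoxArcStateReading
import Summits.CriticalPhenomena.CardyFormulaZ2.Theorems.CardyGluingRDEBoxMergingDyadicSquare

/-! scratch: all H_adj material in one file (split at landing time) -/

noncomputable section

namespace Summit.CriticalPhenomena.CardyFormulaZ2.Theorems

namespace StubShadowingT

open Set Metric
open Literature.Probability.Percolation Literature.Probability.LatticeModels

/-- The unit square window `(0,1)²` (the Literature `sq 1`, disambiguated from `_root_.sq`). -/
abbrev usq : Set ℂ := Literature.Probability.Percolation.sq 1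

/-! ### Coordinates -/

/-- `√3` is irrational: `√3 · b ≠ a` for integers `a` and `b ≠ 0`. -/
theorem sqrt3_mul_int_ne_int (a : ℤ) {b : ℤ} (hb : b ≠ 0) : Real.sqrt 3 * (b : ℝ) ≠ (a : ℝ) := by
  intro h
  have hirr : Irrational (Real.sqrt 3) := Nat.Prime.irrational_sqrt (p := 3) (by norm_num)
  have hb' : (b : ℝ) ≠ 0 := by exact_mod_cast hb
  have e : Real.sqrt 3 = ((a / b : ℚ) : ℝ) := by
    push_cast
    rw [← h, mul_div_cancel_right₀ _ hb']
  exact hirr.ne_rat (a / b) e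

/-- Real part of a mesh point: `δ (x₀ + x₁/2)`. -/
theorem re_triMeshPoint (δ : ℝ) (x : Site 2) :
    (triMeshPoint δ x).re = δ * ((x 0 : ℝ) + (x 1 : ℝ) / 2) := by
  rw [triMeshPoint, Complex.re_ofReal_mul]
  congr 1
  simp [triEmbed, Complex.add_re, Complex.mul_re, triZeta_re, triZeta_im]
  ring

/-- Imaginary part of a mesh point: `δ (√3/2) x₁`. -/
theorem im_triMeshPoint (δ : ℝ) (x : Site 2) :
    (triMeshPoint δ x).im = δ * ((x 1 : ℝ) * (Real.sqrt 3 / 2)) := by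
  rw [triMeshPoint, Complex.im_ofReal_mul]
  congr 1
  simp [triEmbed, Complex.add_im, Complex.mul_im, triZeta_re, triZeta_im]

/-- The top row of the square at mesh `1/N`: the largest `x₁` with `(√3/2) x₁ / N < 1`. -/
def topRow (N : ℕ) : ℕ := ⌊2 * (N : ℝ) / Real.sqrt 3⌋₊

/-- A row `x₁` lies strictly below the top side iff `x₁ ≤ topRow N` (the irrationality of `√3`
excludes equality). -/
theorem sqrt3_mul_lt_iff {N : ℕ} (hN : 1 ≤ N) (b : ℤ) :
    Real.sqrt 3 * (b : ℝ) < 2 * N ↔ b ≤ (topRow N : ℤ) := by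
  have h3 : 0 < Real.sqrt 3 := Real.sqrt_pos.2 (by norm_num)
  have hq : 0 ≤ 2 * (N : ℝ) / Real.sqrt 3 := by positivity
  constructor
  · intro h
    have hb : (b : ℝ) < 2 * N / Real.sqrt 3 := by rw [lt_div_iff₀ h3]; linarith
    by_cases hb0 : b < 0
    · exact le_trans hb0.le (by positivity)
    · push Not at hb0
      obtain ⟨m, rfl⟩ := Int.eq_ofNat_of_zero_le hb0
      have hm : (m : ℝ) ≤ 2 * N / Real.sqrt 3 := by exact_mod_cast hb.le
      have hm' : m ≤ topRow N := Nat.le_floor hm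
      exact_mod_cast hm'
  · intro h
    have hle : (b : ℝ) ≤ topRow N := by exact_mod_cast h
    have hfl : (topRow N : ℝ) ≤ 2 * N / Real.sqrt 3 := Nat.floor_le hq
    have hble : Real.sqrt 3 * (b : ℝ) ≤ 2 * N := by
      have := hle.trans hfl
      rw [le_div_iff₀ h3] at this; linarith
    rcases hble.lt_or_eq with hlt | heq
    · exact hlt
    · exfalso
      by_cases hb0 : b = 0
      · subst hb0
        simp only [Int.cast_zero, mul_zero] at heq
        have : (1 : ℝ) ≤ N := by exact_mod_cast hN
        linarith
      · exact sqrt3_mul_int_ne_int (2 * N) hb0 (by rw [heq]; push_cast; ring)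

/-! ### Mesh vertices of the square -/

/-- The mesh vertices of the unit square at mesh `1/N`, in lattice coordinates. -/
def sqV (N : ℕ) : Set (Site 2) :=
  {x | 1 ≤ 2 * x 0 + x 1 ∧ 2 * x 0 + x 1 ≤ 2 * N - 1 ∧ 1 ≤ x 1 ∧ x 1 ≤ (topRow N : ℤ)}

/-- **Mesh vertices of the square in coordinates**: `δx ∈ (0,1)²` iff `1 ≤ 2x₀ + x₁ ≤ 2N − 1`
and `1 ≤ x₁ ≤ topRow N`. -/
theorem mem_sqV_iff {N : ℕ} (hN : 1 ≤ N) (x : Site 2) :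
    x ∈ triMeshVertices usq (1 / (N : ℝ)) ↔ x ∈ sqV N := by
  have hNpos : (0 : ℝ) < N := by exact_mod_cast hN
  have h3 : 0 < Real.sqrt 3 := Real.sqrt_pos.2 (by norm_num)
  rw [mem_triMeshVertices_iff, usq, Literature.Probability.Percolation.sq, mem_setOf_eq,
    re_triMeshPoint, im_triMeshPoint, sqV, mem_setOf_eq, ← sqrt3_mul_lt_iff hN]
  have e1 : 1 / (N : ℝ) * ((x 0 : ℝ) + (x 1 : ℝ) / 2) = (2 * (x 0 : ℝ) + x 1) / (2 * N) := by
    field_simp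
  have e2 : 1 / (N : ℝ) * ((x 1 : ℝ) * (Real.sqrt 3 / 2)) = Real.sqrt 3 * (x 1 : ℝ) / (2 * N) := by
    field_simp
  rw [e1, e2, div_pos_iff_of_pos_right (by positivity), div_lt_one (by positivity),
    div_pos_iff_of_pos_right (by positivity), div_lt_one (by positivity)]
  constructor
  · rintro ⟨g1, g2, g3, g4⟩
    have i1 : (0 : ℤ) < 2 * x 0 + x 1 := by exact_mod_cast g1
    have i2 : 2 * x 0 + x 1 < 2 * (N : ℤ) := by exact_mod_cast g2
    have i3 : (0 : ℝ) < x 1 := by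
      by_contra h
      push Not at h
      nlinarith
    have i3' : (0 : ℤ) < x 1 := by exact_mod_cast i3
    exact ⟨by omega, by omega, by omega, g4⟩
  · rintro ⟨g1, g2, g3, g4⟩
    have e1 : (1 : ℝ) ≤ 2 * x 0 + x 1 := by exact_mod_cast g1
    have e2 : (2 * x 0 + x 1 : ℝ) ≤ 2 * N - 1 := by
      have : ((2 * x 0 + x 1 : ℤ) : ℝ) ≤ ((2 * (N : ℤ) - 1 : ℤ) : ℝ) := by exact_mod_cast g2
      push_cast at this
      exact this
    have e3 : (1 : ℝ) ≤ x 1 := by exact_mod_cast g3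
    exact ⟨by linarith, by linarith, by positivity, g4⟩

/-! ### The mesh graph of the square: convexity -/

/-- The unit square is convex. -/
theorem convex_usq : Convex ℝ usq := by
  have e : usq = (({z : ℂ | 0 < z.re} ∩ {z : ℂ | z.re < 1}) ∩ {z : ℂ | 0 < z.im}) ∩
      {z : ℂ | z.im < 1} := by
    ext z
    simp only [usq, Literature.Probability.Percolation.sq, mem_setOf_eq, mem_inter_iff]
    tauto
  rw [e]
  exact (((convex_halfSpace_re_gt 0).inter (convex_halfSpace_re_lt 1)).inter
    (convex_halfSpace_im_gt 0)).inter (convex_halfSpace_im_lt 1)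

/-- Two `𝕋`-adjacent mesh vertices of the square are adjacent in its mesh graph (the closed
segment between two points of the convex square lies in its closure). -/
theorem triMeshGraph_sq_adj {N : ℕ} {x y : Site 2} (hx : x ∈ triMeshVertices usq (1 / (N : ℝ)))
    (hy : y ∈ triMeshVertices usq (1 / (N : ℝ))) (hxy : triGraph.Adj x y) :
    (triMeshGraph usq (1 / (N : ℝ))).Adj x y :=
  triMeshGraph_adj_iff.2 ⟨hxy, (convex_usq.segment_subset hx hy).trans subset_closure⟩

/-! ### Connectivity: the discrete domain is all of the mesh vertices -/

/-- The base vertex `(0, 1)` (bottom-left boundary vertex of the square). -/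
def sqBase : Site 2 := ![0, 1]

/-- `topRow N ≥ 1` for `N ≥ 1` (`√3 < 2 ≤ 2N`). -/
theorem one_le_topRow {N : ℕ} (hN : 1 ≤ N) : (1 : ℤ) ≤ topRow N := by
  refine (sqrt3_mul_lt_iff hN 1).1 ?_
  have h3 : Real.sqrt 3 < 2 := by
    rw [Real.sqrt_lt' (by norm_num)]; norm_num
  have : (1 : ℝ) ≤ N := by exact_mod_cast hN
  push_cast
  linarith

/-- The base vertex is a mesh vertex (`N ≥ 1`). -/
theorem sqBase_mem {N : ℕ} (hN : 1 ≤ N) : sqBase ∈ triMeshVertices usq (1 / (N : ℝ)) :=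
  (mem_sqV_iff hN _).2 ⟨by simp [sqBase], by simp [sqBase]; omega, by simp [sqBase],
    by simpa [sqBase] using one_le_topRow hN⟩

/-- Every mesh vertex of the square is joined in the mesh vertex graph to the base vertex
`(0, 1)` (walk down to row `1` — straight down, or down-right on the left edge — then left along
row `1`). -/
theorem sqV_reachable_base {N : ℕ} (hN : 2 ≤ N) (x : Site 2)
    (hx : x ∈ triMeshVertices usq (1 / (N : ℝ))) :
    (triMeshVertexGraph usq (1 / (N : ℝ))).Reachable ⟨x, hx⟩
      ⟨sqBase, sqBase_mem ((Nat.le_succ 1).trans hN)⟩ := by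
  have hN1 : 1 ≤ N := (Nat.le_succ 1).trans hN
  -- strong induction on the measure `2 x₀ + 3 x₁ - 3 ≥ 0`
  suffices key : ∀ (n : ℕ) (y : Site 2) (hy : y ∈ triMeshVertices usq (1 / (N : ℝ))),
      (2 * y 0 + 3 * y 1 - 3).toNat = n →
      (triMeshVertexGraph usq (1 / (N : ℝ))).Reachable ⟨y, hy⟩ ⟨sqBase, sqBase_mem hN1⟩ from
    key _ x hx rfl
  intro n
  induction n using Nat.strong_induction_on with
  | _ n ih =>
    intro y hy hn
    obtain ⟨g1, g2, g3, g4⟩ := (mem_sqV_iff hN1 y).1 hy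
    -- one step to an adjacent mesh vertex `z` of smaller measure, then the induction hypothesis
    have step : ∀ z : Site 2, z ∈ sqV N → triGraph.Adj y z →
        (2 * z 0 + 3 * z 1 - 3).toNat < n →
        (triMeshVertexGraph usq (1 / (N : ℝ))).Reachable ⟨y, hy⟩ ⟨sqBase, sqBase_mem hN1⟩ := by
      intro z hz hadj hlt
      have hzV : z ∈ triMeshVertices usq (1 / (N : ℝ)) := (mem_sqV_iff hN1 z).2 hz
      have hyz : (triMeshVertexGraph usq (1 / (N : ℝ))).Adj ⟨y, hy⟩ ⟨z, hzV⟩ :=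
        SimpleGraph.induce_adj.2 (triMeshGraph_sq_adj hy hzV hadj)
      exact hyz.reachable.trans (ih _ hlt z hzV rfl)
    by_cases hrow : y 1 = 1
    · by_cases hcol : y 0 = 0
      · have : y = sqBase := by
          ext i; fin_cases i <;> simp [sqBase, hrow, hcol]
        subst this
        rfl
      · -- left along row 1
        refine step ![y 0 - 1, 1] ⟨?_, ?_, ?_, ?_⟩ ?_ ?_
        · simp; omega
        · simp; omega
        · simp
        · simp; omega
        · rw [triGraph_adj_iff_coord]; simp [hrow]
        · rw [← hn]; simp [hrow]; omega
    · by_cases hc : 2 ≤ 2 * y 0 + y 1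
      · -- straight down
        refine step ![y 0, y 1 - 1] ⟨?_, ?_, ?_, ?_⟩ ?_ ?_
        · simp; omega
        · simp; omega
        · simp; omega
        · simp; omega
        · rw [triGraph_adj_iff_coord]; simp
        · rw [← hn]; simp; omega
      · -- down-right (on the left edge `2 y₀ + y₁ = 1`)
        refine step ![y 0 + 1, y 1 - 1] ⟨?_, ?_, ?_, ?_⟩ ?_ ?_
        · simp; omega
        · simp; omega
        · simp; omega
        · simp; omega
        · rw [triGraph_adj_iff_coord]; simp
        · rw [← hn]; simp; omega

/-- The mesh vertex graph of the square is preconnected. -/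
theorem triMeshVertexGraph_sq_preconnected {N : ℕ} (hN : 2 ≤ N) :
    (triMeshVertexGraph usq (1 / (N : ℝ))).Preconnected := fun u v =>
  (sqV_reachable_base hN u.1 u.2).trans (sqV_reachable_base hN v.1 v.2).symm

/-- **The discrete domain of the square is all of its mesh vertices** (`N ≥ 2`): the "largest
connected component" recipe of `triMeshDomain` is trivial for the (convex) square. -/
theorem triMeshDomain_sq {N : ℕ} (hN : 2 ≤ N) :
    triMeshDomain usq (1 / (N : ℝ)) = triMeshVertices usq (1 / (N : ℝ)) := by
  refine Subset.antisymm (triMeshDomain_subset_triMeshVertices _ _) fun v hv => ?_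
  have hsub := (triMeshVertexGraph_sq_preconnected hN).subsingleton_connectedComponent
  simp only [triMeshDomain, mem_iUnion, mem_image]
  refine ⟨(triMeshVertexGraph usq (1 / (N : ℝ))).connectedComponentMk ⟨v, hv⟩, fun C' => ?_,
    ⟨v, hv⟩, ?_, rfl⟩
  · rw [Subsingleton.elim C' ((triMeshVertexGraph usq (1 / (N : ℝ))).connectedComponentMk ⟨v, hv⟩)]
  · rw [SimpleGraph.ConnectedComponent.mem_supp_iff]

/-- Membership in the discrete domain of the square, in coordinates. -/
theorem mem_triMeshDomain_sq_iff {N : ℕ} (hN : 2 ≤ N) (x : Site 2) :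
    x ∈ triMeshDomain usq (1 / (N : ℝ)) ↔ x ∈ sqV N := by
  rw [triMeshDomain_sq hN, mem_sqV_iff ((Nat.le_succ 1).trans hN)]

/-! ### The domain graph, open paths, the discrete boundary -/

/-- Two `𝕋`-adjacent mesh vertices of the square are adjacent in `Ω_δ`. -/
theorem triDiscreteDomainGraph_sq_adj {N : ℕ} (hN : 2 ≤ N) {x y : Site 2} (hx : x ∈ sqV N)
    (hy : y ∈ sqV N) (hxy : triGraph.Adj x y) :
    (triDiscreteDomainGraph usq (1 / (N : ℝ))).Adj x y := by
  have hx' := (mem_sqV_iff ((Nat.le_succ 1).trans hN) x).2 hx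
  have hy' := (mem_sqV_iff ((Nat.le_succ 1).trans hN) y).2 hy
  exact triDiscreteDomainGraph_adj_iff.2 ⟨triMeshGraph_sq_adj hx' hy' hxy,
    (mem_triMeshDomain_sq_iff hN x).2 hx, (mem_triMeshDomain_sq_iff hN y).2 hy⟩

/-- **An open `𝕋`-path of mesh vertices of the square is an open path of `Ω_δ`**: a `𝕋`-path
inside `sqV N ∩ ω` from `x` to `y` witnesses `ω ∈ {x ⟷ y in Ω_δ}` (`siteConnIn` for the domain
graph). -/
theorem siteConnIn_sq_of_pathIn {N : ℕ} (hN : 2 ≤ N) {ω : SiteConfig (Site 2)} {x y : Site 2}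
    (h : PathIn triGraph (sqV N ∩ ω) x y) :
    ω ∈ siteConnIn (triDiscreteDomainGraph usq (1 / (N : ℝ))) (triMeshDomain usq (1 / (N : ℝ))) x y := by
  refine PathIn.mem_siteConnIn (PathIn.mono_of_adj (G' := triDiscreteDomainGraph usq (1 / (N : ℝ)))
    (A' := triMeshDomain usq (1 / (N : ℝ)) ∩ ω) (fun a ha b hb hab => ?_) (fun a ha => ?_) h)
  · exact triDiscreteDomainGraph_sq_adj hN ha.1 hb.1 hab
  · exact ⟨(mem_triMeshDomain_sq_iff hN a).2 ha.1, ha.2⟩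

/-- **Boundary vertices of the square in coordinates**: a mesh vertex is a boundary vertex of
`Ω_δ` iff one of its six `𝕋`-neighbours is not a mesh vertex. -/
theorem mem_triMeshBoundary_sq_iff {N : ℕ} (hN : 2 ≤ N) {x : Site 2} (hx : x ∈ sqV N) :
    x ∈ triMeshBoundary usq (1 / (N : ℝ)) ↔ ∃ y, triGraph.Adj x y ∧ y ∉ sqV N := by
  rw [mem_triMeshBoundary_iff]
  constructor
  · rintro ⟨-, y, hxy, hnadj⟩
    refine ⟨y, hxy, fun hy => hnadj (triDiscreteDomainGraph_sq_adj hN hx hy hxy)⟩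
  · rintro ⟨y, hxy, hy⟩
    refine ⟨(mem_triMeshDomain_sq_iff hN x).2 hx, y, hxy, fun hadj => hy ?_⟩
    exact (mem_triMeshDomain_sq_iff hN y).1 (triDiscreteDomainGraph_adj_iff.1 hadj).2.2

/-! ### A geometry-free criterion for discrete arcs -/

/-- **Discrete-arc membership from distances.** A boundary vertex `x` of `Ω_δ` with a point of
`A` within `d` of `δx`, such that every frontier point NOT in `A` is at distance `≥ d` from
`δx`, lies in the discrete arc of `A` (for `frontier Ω \\ A` nonempty). -/
theorem mem_triDiscreteArc_of_forall_dist {Ω : Set ℂ} {δ : ℝ} {A : Set ℂ} {x : Site 2} {d : ℝ}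
    (hx : x ∈ triMeshBoundary Ω δ) {a : ℂ} (ha : a ∈ A) (hda : dist (triMeshPoint δ x) a ≤ d)
    (hfar : ∀ z ∈ frontier Ω, z ∉ A → d ≤ dist (triMeshPoint δ x) z)
    (hne : (frontier Ω \ A).Nonempty) : x ∈ triDiscreteArc Ω δ A := by
  rw [mem_triDiscreteArc_iff]
  refine ⟨hx, (infDist_le_dist_of_mem ha).trans (hda.trans ?_)⟩
  exact (le_infDist hne).2 fun z hz => hfar z hz.1 hz.2


/-! ## Painting -/

open Set
open Literature.Probability.Percolation Literature.Probability.LatticeModels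

/-- **Junction dichotomy (painting + Hex lemma).**  See the module docstring.  With the colouring
`χ = BL ∪ BR ∪ (J ∩ ω)` of the parallelogram `S = triStrip a b w h`: either a `𝕋`-path of open
free sites from a neighbour of `BL` to a neighbour of `BR`, or a `𝕋`-path of closed free sites
from a neighbour of `W` to a neighbour of `F`. -/
theorem junction_dichotomy {a b : ℤ} {w h : ℕ} {BL BR W F J : Set (Site 2)}
    (hcover : triStrip a b w h ⊆ BL ∪ BR ∪ W ∪ F ∪ J)
    (hW : Disjoint W (BL ∪ BR ∪ J)) (hF : Disjoint F (BL ∪ BR ∪ J))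
    (hBLBR : Disjoint BL BR) (hadjBLBR : ∀ x ∈ BL, ∀ y ∈ BR, ¬ triGraph.Adj x y)
    (hWF : Disjoint W F) (hadjWF : ∀ x ∈ W, ∀ y ∈ F, ¬ triGraph.Adj x y)
    (hLcol : ∀ z ∈ triStrip a b w h, z 0 = a → z ∈ BL ∪ W ∪ F)
    (hRcol : ∀ z ∈ triStrip a b w h, z 0 = a + w → z ∈ BR ∪ W ∪ F)
    (hBrow : ∀ z ∈ triStrip a b w h, z 1 = b → z ∈ BL ∪ BR ∪ W)
    (hTrow : ∀ z ∈ triStrip a b w h, z 1 = b + h → z ∈ BL ∪ BR ∪ F)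
    (ω : SiteConfig (Site 2)) :
    (∃ b₁ ∈ BL, ∃ b₂ ∈ BR, ∃ x y : Site 2, triGraph.Adj b₁ x ∧ triGraph.Adj y b₂ ∧
        PathIn triGraph (J ∩ ω) x y) ∨
      (∃ w₁ ∈ W, ∃ f₂ ∈ F, ∃ x y : Site 2, triGraph.Adj w₁ x ∧ triGraph.Adj y f₂ ∧
        PathIn triGraph (J \ ω) x y) := by
  classical
  set S := triStrip a b w h with hS
  set χ : Set (Site 2) := BL ∪ BR ∪ (J ∩ ω) with hχ
  -- colour bookkeeping
  have hWχ : ∀ z ∈ W, z ∉ χ := fun z hz hzχ => by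
    rcases hzχ with (h | h) | h
    · exact hW.le_bot ⟨hz, Or.inl (Or.inl h)⟩
    · exact hW.le_bot ⟨hz, Or.inl (Or.inr h)⟩
    · exact hW.le_bot ⟨hz, Or.inr h.1⟩
  have hFχ : ∀ z ∈ F, z ∉ χ := fun z hz hzχ => by
    rcases hzχ with (h | h) | h
    · exact hF.le_bot ⟨hz, Or.inl (Or.inl h)⟩
    · exact hF.le_bot ⟨hz, Or.inl (Or.inr h)⟩
    · exact hF.le_bot ⟨hz, Or.inr h.1⟩
  have hBLχ : BL ⊆ χ := fun z hz => Or.inl (Or.inl hz)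
  have hBRχ : BR ⊆ χ := fun z hz => Or.inl (Or.inr hz)
  rcases hPath_or_compl_vPath a b w h χ with ⟨s, e, hs, he, P⟩ | ⟨s, e, hs, he, Q⟩
  · -- a black left–right crossing: from `BL` to `BR`
    left
    have hsS : s ∈ S := P.left_mem.1
    have heS : e ∈ S := P.right_mem.1
    have hsBL : s ∈ BL := by
      rcases hLcol s hsS hs with (h | h) | h
      · exact h
      · exact absurd P.left_mem.2 (hWχ s h)
      · exact absurd P.left_mem.2 (hFχ s h)
    have heBR : e ∈ BR := by
      rcases hRcol e heS he with (h | h) | h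
      · exact h
      · exact absurd P.right_mem.2 (hWχ e h)
      · exact absurd P.right_mem.2 (hFχ e h)
    have heBL : e ∉ BL := fun h' => hBLBR.le_bot ⟨h', heBR⟩
    -- last exit from `BL`
    obtain ⟨b₁, x, hb₁, -, hxBL, hadj₁, P'⟩ := P.last_exit hsBL heBL
    have hxχ : x ∈ S ∩ χ := (P'.left_mem).1
    have hxBR : x ∉ BR := fun h' => hadjBLBR b₁ hb₁ x h' hadj₁
    -- first entry into `BR`
    obtain ⟨y, b₂, hyR, hb₂R, -, hadj₂, P''⟩ := P'.exit (R := BRᶜ) hxBR (fun h' => h' heBR)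
    have hb₂ : b₂ ∈ BR := not_not.1 hb₂R
    refine ⟨b₁, hb₁, b₂, hb₂, x, y, hadj₁, hadj₂, P''.mono ?_⟩
    rintro z ⟨hzBR, ⟨hzS, hzχ⟩, hzBL⟩
    rcases hzχ with (h | h) | h
    · exact absurd h hzBL
    · exact absurd h hzBR
    · exact h
  · -- a white bottom–top crossing: from `W` to `F`
    right
    have hsS : s ∈ S := Q.left_mem.1
    have heS : e ∈ S := Q.right_mem.1
    have hsW : s ∈ W := by
      rcases hBrow s hsS hs with (h | h) | h
      · exact absurd (hBLχ h) Q.left_mem.2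
      · exact absurd (hBRχ h) Q.left_mem.2
      · exact h
    have heF : e ∈ F := by
      rcases hTrow e heS he with (h | h) | h
      · exact absurd (hBLχ h) Q.right_mem.2
      · exact absurd (hBRχ h) Q.right_mem.2
      · exact h
    have heW : e ∉ W := fun h' => hWF.le_bot ⟨h', heF⟩
    obtain ⟨w₁, x, hw₁, -, hxW, hadj₁, Q'⟩ := Q.last_exit hsW heW
    have hxF : x ∉ F := fun h' => hadjWF w₁ hw₁ x h' hadj₁
    obtain ⟨y, f₂, hyR, hf₂R, -, hadj₂, Q''⟩ := Q'.exit (R := Fᶜ) hxF (fun h' => h' heF)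
    have hf₂ : f₂ ∈ F := not_not.1 hf₂R
    refine ⟨w₁, hw₁, f₂, hf₂, x, y, hadj₁, hadj₂, Q''.mono ?_⟩
    rintro z ⟨hzF, ⟨hzS, hzχ⟩, hzW⟩
    have hz := hcover hzS
    rcases hz with (((h | h) | h) | h) | h
    · exact absurd (hBLχ h) hzχ
    · exact absurd (hBRχ h) hzχ
    · exact absurd h hzW
    · exact absurd h hzF
    · exact ⟨h, fun hzω => hzχ (Or.inr ⟨h, hzω⟩)⟩


/-! ## Distances to the frontier of the square; discrete arcs of its sides -/

section Arcs

open Complex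

/-- The frontier of the unit square: the four closed sides. -/
theorem frontier_usq : frontier usq = Icc (0 : ℝ) 1 ×ℂ {0, 1} ∪ {0, 1} ×ℂ Icc (0 : ℝ) 1 :=
  BoxMerging_frontier_sq one_pos

/-- **Distance from an interior point to the frontier**: a point of the plane whose four
coordinate gaps `q.im`, `1 - q.im`, `q.re`, `1 - q.re` are all `≥ d` is at distance `≥ d` from
every frontier point of the square. -/
theorem le_dist_of_mem_frontier_usq {q : ℂ} {d : ℝ} (hb : d ≤ q.im) (ht : d ≤ 1 - q.im)
    (hl : d ≤ q.re) (hr : d ≤ 1 - q.re) : ∀ z ∈ frontier usq, d ≤ dist q z := by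
  intro z hz
  rw [frontier_usq] at hz
  have hre : |(q - z).re| ≤ dist q z := by rw [dist_eq_norm]; exact abs_re_le_norm _
  have him : |(q - z).im| ≤ dist q z := by rw [dist_eq_norm]; exact abs_im_le_norm _
  simp only [sub_re, sub_im] at hre him
  rcases hz with hz | hz
  · obtain ⟨-, hzi⟩ := mem_reProdIm.1 hz
    rcases hzi with h0 | h1
    · rw [h0, sub_zero] at him
      exact (hb.trans (le_abs_self _)).trans him
    · rw [mem_singleton_iff] at h1
      rw [h1] at him
      have : 1 - q.im ≤ |q.im - 1| := by rw [abs_sub_comm]; exact le_abs_self _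
      exact (ht.trans this).trans him
  · obtain ⟨hzr, -⟩ := mem_reProdIm.1 hz
    rcases hzr with h0 | h1
    · rw [h0, sub_zero] at hre
      exact (hl.trans (le_abs_self _)).trans hre
    · rw [mem_singleton_iff] at h1
      rw [h1] at hre
      have : 1 - q.re ≤ |q.re - 1| := by rw [abs_sub_comm]; exact le_abs_self _
      exact (hr.trans this).trans hre

/-- Discrete-arc membership in the square from the four coordinate gaps. -/
theorem mem_triDiscreteArc_usq {δ : ℝ} {x : Site 2} (hx : x ∈ triMeshBoundary usq δ)
    {A : Set ℂ} {a : ℂ} (ha : a ∈ A) {d : ℝ} (hda : dist (triMeshPoint δ x) a ≤ d)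
    (hb : d ≤ (triMeshPoint δ x).im) (ht : d ≤ 1 - (triMeshPoint δ x).im)
    (hl : d ≤ (triMeshPoint δ x).re) (hr : d ≤ 1 - (triMeshPoint δ x).re)
    (hne : (frontier usq \ A).Nonempty) : x ∈ triDiscreteArc usq δ A :=
  mem_triDiscreteArc_of_forall_dist hx ha hda
    (fun z hz _ => le_dist_of_mem_frontier_usq hb ht hl hr z hz) hne

/-- Numerical facts about `√3`: `1 < √3 < 2`. -/
theorem sqrt3_bounds : 1 < Real.sqrt 3 ∧ Real.sqrt 3 < 2 := by
  constructor
  · rw [Real.lt_sqrt (by norm_num)]; norm_num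
  · rw [Real.sqrt_lt' (by norm_num)]; norm_num

section DivHelpers

variable {D P Q : ℝ}

/-- `P ≤ Q → P/D ≤ Q/D` (`D > 0`). -/
theorem divh₁ (hD : 0 < D) (h : P ≤ Q) : P / D ≤ Q / D := div_le_div_of_nonneg_right h hD.le

/-- `P + Q ≤ D → P/D ≤ 1 - Q/D` (`D > 0`). -/
theorem divh₂ (hD : 0 < D) (h : P + Q ≤ D) : P / D ≤ 1 - Q / D := by
  rw [le_sub_iff_add_le, ← add_div, div_le_one hD]; exact h

/-- `D ≤ P + Q → 1 - Q/D ≤ P/D` (`D > 0`). -/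
theorem divh₃ (hD : 0 < D) (h : D ≤ P + Q) : 1 - Q / D ≤ P / D := by
  rw [sub_le_iff_le_add, ← add_div, one_le_div hD]; exact h

/-- `Q ≤ P → 1 - P/D ≤ 1 - Q/D` (`D > 0`). -/
theorem divh₄ (hD : 0 < D) (h : Q ≤ P) : 1 - P / D ≤ 1 - Q / D :=
  sub_le_sub_left (div_le_div_of_nonneg_right h hD.le) 1

end DivHelpers

variable {N : ℕ}

/-- Coordinates of a mesh point at mesh `1/N` over the common denominator `2N`:
`re = (2x₀ + x₁)/(2N)`, `im = √3 x₁/(2N)`. -/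
theorem re_im_mesh (hN : 1 ≤ N) (x : Site 2) :
    (triMeshPoint (1 / (N : ℝ)) x).re = (2 * (x 0 : ℝ) + x 1) / (2 * N) ∧
      (triMeshPoint (1 / (N : ℝ)) x).im = Real.sqrt 3 * (x 1 : ℝ) / (2 * N) := by
  have hN' : (N : ℝ) ≠ 0 := Nat.cast_ne_zero.2 (by omega)
  rw [re_triMeshPoint, im_triMeshPoint]
  constructor
  · field_simp
  · field_simp

/-- Casting an integer inequality to `ℝ` (convenience). -/
theorem int_cast_le {a b : ℤ} (h : a ≤ b) : (a : ℝ) ≤ (b : ℝ) := by exact_mod_cast h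

/-- **Bottom row.** A mesh vertex of the bottom row `x₁ = 1` with `1 ≤ x₀ ≤ N − 2` lies in the
discrete arc of every boundary piece `A` containing the foot `(re δx, 0)` of its mesh point (and
leaving out some frontier point). -/
theorem bottom_mem_triDiscreteArc (hN : 2 ≤ N) {x : Site 2} (hx : x ∈ sqV N) (h1 : x 1 = 1)
    (hx0 : 1 ≤ x 0) (hx0' : x 0 ≤ (N : ℤ) - 2) {A : Set ℂ}
    (hA : (⟨(triMeshPoint (1 / (N : ℝ)) x).re, 0⟩ : ℂ) ∈ A) (hne : (frontier usq \ A).Nonempty) :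
    x ∈ triDiscreteArc usq (1 / (N : ℝ)) A := by
  have hN1 : 1 ≤ N := (Nat.le_succ 1).trans hN
  have hNr : (2 : ℝ) ≤ N := by exact_mod_cast hN
  have hD : (0 : ℝ) < 2 * N := by linarith
  obtain ⟨s1, s2⟩ := sqrt3_bounds
  obtain ⟨hre, him⟩ := re_im_mesh hN1 x
  have e0 : (x 1 : ℝ) = 1 := by exact_mod_cast h1
  have f0 : (1 : ℝ) ≤ x 0 := by exact_mod_cast hx0
  have f1 := int_cast_le hx0'
  push_cast at f1
  rw [e0] at hre him
  have hbd : x ∈ triMeshBoundary usq (1 / (N : ℝ)) := by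
    refine (mem_triMeshBoundary_sq_iff hN hx).2 ⟨![x 0, 0], ?_, ?_⟩
    · rw [triGraph_adj_iff_coord]; simp [h1]
    · simp [sqV]
  have hd : dist (triMeshPoint (1 / (N : ℝ)) x) ⟨(triMeshPoint (1 / (N : ℝ)) x).re, 0⟩ =
      (triMeshPoint (1 / (N : ℝ)) x).im := by
    rw [dist_of_re_eq (z := triMeshPoint (1 / (N : ℝ)) x)
      (w := ⟨(triMeshPoint (1 / (N : ℝ)) x).re, 0⟩) rfl, Real.dist_eq, sub_zero,
      abs_of_nonneg]
    rw [him]; positivity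
  refine mem_triDiscreteArc_usq hbd hA hd.le le_rfl ?_ ?_ ?_ hne
  · rw [him]; exact divh₂ hD (by nlinarith)
  · rw [him, hre]; exact divh₁ hD (by nlinarith)
  · rw [him, hre]; exact divh₂ hD (by nlinarith)

/-- `topRow N` is the last row strictly below the top side:
`√3 · topRow N < 2N ≤ √3 (topRow N + 1)`. -/
theorem topRow_spec (hN : 1 ≤ N) :
    Real.sqrt 3 * (topRow N : ℝ) < 2 * N ∧ 2 * (N : ℝ) ≤ Real.sqrt 3 * ((topRow N : ℝ) + 1) := by
  constructor
  · have := (sqrt3_mul_lt_iff hN (topRow N)).2 le_rfl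
    exact_mod_cast this
  · by_contra h
    push Not at h
    have := (sqrt3_mul_lt_iff hN ((topRow N : ℤ) + 1)).1 (by push_cast; exact h)
    omega

/-- **Top row.** A mesh vertex of the top row `x₁ = topRow N` with `2 ≤ 2x₀ + x₁ ≤ 2N − 2`
lies in the discrete arc of every boundary piece containing the head `(re δx, 1)` of its mesh
point. -/
theorem top_mem_triDiscreteArc (hN : 2 ≤ N) {x : Site 2} (hx : x ∈ sqV N)
    (h1 : x 1 = (topRow N : ℤ)) (hx0 : 2 ≤ 2 * x 0 + x 1) (hx0' : 2 * x 0 + x 1 ≤ 2 * (N : ℤ) - 2)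
    {A : Set ℂ} (hA : (⟨(triMeshPoint (1 / (N : ℝ)) x).re, 1⟩ : ℂ) ∈ A)
    (hne : (frontier usq \ A).Nonempty) :
    x ∈ triDiscreteArc usq (1 / (N : ℝ)) A := by
  have hN1 : 1 ≤ N := (Nat.le_succ 1).trans hN
  have hNr : (2 : ℝ) ≤ N := by exact_mod_cast hN
  have hD : (0 : ℝ) < 2 * N := by linarith
  obtain ⟨s1, s2⟩ := sqrt3_bounds
  obtain ⟨hre, him⟩ := re_im_mesh hN1 x
  obtain ⟨t1, t2⟩ := topRow_spec hN1
  have e0 : (x 1 : ℝ) = topRow N := by exact_mod_cast h1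
  have f0 := int_cast_le hx0
  have f1 := int_cast_le hx0'
  push_cast at f0 f1
  have hM1 : (1 : ℝ) ≤ topRow N := by exact_mod_cast one_le_topRow hN1
  have hbd : x ∈ triMeshBoundary usq (1 / (N : ℝ)) := by
    refine (mem_triMeshBoundary_sq_iff hN hx).2 ⟨![x 0, x 1 + 1], ?_, ?_⟩
    · rw [triGraph_adj_iff_coord]; simp
    · simp [sqV, h1]
  rw [e0] at him hre
  have hlt : (triMeshPoint (1 / (N : ℝ)) x).im < 1 := by
    rw [him, div_lt_one hD]; linarith
  have hd : dist (triMeshPoint (1 / (N : ℝ)) x) ⟨(triMeshPoint (1 / (N : ℝ)) x).re, 1⟩ =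
      1 - (triMeshPoint (1 / (N : ℝ)) x).im := by
    rw [dist_of_re_eq (z := triMeshPoint (1 / (N : ℝ)) x)
      (w := ⟨(triMeshPoint (1 / (N : ℝ)) x).re, 1⟩) rfl, Real.dist_eq,
      abs_sub_comm, abs_of_nonneg (by linarith)]
  refine mem_triDiscreteArc_usq hbd hA hd.le ?_ le_rfl ?_ ?_ hne
  · rw [him]; exact divh₃ hD (by nlinarith)
  · rw [him, hre]; exact divh₃ hD (by nlinarith)
  · rw [him, hre]; exact divh₄ hD (by nlinarith)

/-- **Left zigzag.** A mesh vertex with `2x₀ + x₁ ≤ 2` (so `∈ {1, 2}`), `2x₀ + x₁ ≤ x₁ ≤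
topRow N − 2` lies in the discrete arc of every boundary piece containing the projection
`(0, im δx)` of its mesh point on the left side. -/
theorem left_mem_triDiscreteArc (hN : 2 ≤ N) {x : Site 2} (hx : x ∈ sqV N)
    (hs : 2 * x 0 + x 1 ≤ 2) (hsx : 2 * x 0 + x 1 ≤ x 1) (htop : x 1 ≤ (topRow N : ℤ) - 2)
    {A : Set ℂ} (hA : (⟨0, (triMeshPoint (1 / (N : ℝ)) x).im⟩ : ℂ) ∈ A)
    (hne : (frontier usq \ A).Nonempty) :
    x ∈ triDiscreteArc usq (1 / (N : ℝ)) A := by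
  have hN1 : 1 ≤ N := (Nat.le_succ 1).trans hN
  have hNr : (2 : ℝ) ≤ N := by exact_mod_cast hN
  have hD : (0 : ℝ) < 2 * N := by linarith
  obtain ⟨s1, s2⟩ := sqrt3_bounds
  obtain ⟨hre, him⟩ := re_im_mesh hN1 x
  obtain ⟨t1, t2⟩ := topRow_spec hN1
  obtain ⟨g1, g2, g3, g4⟩ := hx
  have f1 := int_cast_le g1
  have f2 := int_cast_le hsx
  have f3 := int_cast_le htop
  have f4 := int_cast_le hs
  have f5 := int_cast_le g3
  push_cast at f1 f2 f3 f4 f5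
  have hbd : x ∈ triMeshBoundary usq (1 / (N : ℝ)) := by
    refine (mem_triMeshBoundary_sq_iff hN ⟨g1, g2, g3, g4⟩).2 ⟨![x 0 - 1, x 1], ?_, ?_⟩
    · rw [triGraph_adj_iff_coord]; simp
    · simp [sqV]; omega
  have hd : dist (triMeshPoint (1 / (N : ℝ)) x) ⟨0, (triMeshPoint (1 / (N : ℝ)) x).im⟩ =
      (triMeshPoint (1 / (N : ℝ)) x).re := by
    rw [dist_of_im_eq (z := triMeshPoint (1 / (N : ℝ)) x)
      (w := ⟨0, (triMeshPoint (1 / (N : ℝ)) x).im⟩) rfl, Real.dist_eq, sub_zero,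
      abs_of_nonneg]
    rw [hre]; positivity
  refine mem_triDiscreteArc_usq hbd hA hd.le ?_ ?_ le_rfl ?_ hne
  · rw [hre, him]; exact divh₁ hD (by nlinarith)
  · rw [hre, him]; exact divh₂ hD (by nlinarith)
  · rw [hre]; exact divh₂ hD (by nlinarith)

/-- **Right zigzag.** A mesh vertex with `2N − 2 ≤ 2x₀ + x₁`, `2N − (2x₀ + x₁) ≤ x₁ ≤
topRow N − 2` lies in the discrete arc of every boundary piece containing the projection
`(1, im δx)` of its mesh point on the right side. -/
theorem right_mem_triDiscreteArc (hN : 2 ≤ N) {x : Site 2} (hx : x ∈ sqV N)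
    (hs : 2 * (N : ℤ) - 2 ≤ 2 * x 0 + x 1) (hsx : 2 * (N : ℤ) - (2 * x 0 + x 1) ≤ x 1)
    (htop : x 1 ≤ (topRow N : ℤ) - 2)
    {A : Set ℂ} (hA : (⟨1, (triMeshPoint (1 / (N : ℝ)) x).im⟩ : ℂ) ∈ A)
    (hne : (frontier usq \ A).Nonempty) :
    x ∈ triDiscreteArc usq (1 / (N : ℝ)) A := by
  have hN1 : 1 ≤ N := (Nat.le_succ 1).trans hN
  have hNr : (2 : ℝ) ≤ N := by exact_mod_cast hN
  have hD : (0 : ℝ) < 2 * N := by linarith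
  obtain ⟨s1, s2⟩ := sqrt3_bounds
  obtain ⟨hre, him⟩ := re_im_mesh hN1 x
  obtain ⟨t1, t2⟩ := topRow_spec hN1
  obtain ⟨g1, g2, g3, g4⟩ := hx
  have f1 := int_cast_le hs
  have f2 := int_cast_le hsx
  have f3 := int_cast_le htop
  have f4 := int_cast_le g2
  have f5 := int_cast_le g3
  push_cast at f1 f2 f3 f4 f5
  have hbd : x ∈ triMeshBoundary usq (1 / (N : ℝ)) := by
    refine (mem_triMeshBoundary_sq_iff hN ⟨g1, g2, g3, g4⟩).2 ⟨![x 0 + 1, x 1], ?_, ?_⟩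
    · rw [triGraph_adj_iff_coord]; simp
    · simp [sqV]; omega
  have hle : (triMeshPoint (1 / (N : ℝ)) x).re ≤ 1 := by
    rw [hre, div_le_one hD]; linarith
  have hd : dist (triMeshPoint (1 / (N : ℝ)) x) ⟨1, (triMeshPoint (1 / (N : ℝ)) x).im⟩ =
      1 - (triMeshPoint (1 / (N : ℝ)) x).re := by
    rw [dist_of_im_eq (z := triMeshPoint (1 / (N : ℝ)) x)
      (w := ⟨1, (triMeshPoint (1 / (N : ℝ)) x).im⟩) rfl, Real.dist_eq,
      abs_sub_comm, abs_of_nonneg (by linarith)]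
  refine mem_triDiscreteArc_usq hbd hA hd.le ?_ ?_ ?_ le_rfl hne
  · rw [hre, him]; exact divh₃ hD (by nlinarith)
  · rw [hre, him]; exact divh₄ hD (by nlinarith)
  · rw [hre]; exact divh₃ hD (by nlinarith)

end Arcs

/-! ## From a junction configuration to the annulus bound -/

section Junction

open MeasureTheory Filter
open scoped Topology

variable {N : ℕ}

/-- **Lower bound on mesh distances from the hexagonal norm**: `dist (δy) (δq) ≥ (√3/2) δ |y - q|_𝕋`. -/
theorem hex_le_dist {δ : ℝ} (hδ : 0 ≤ δ) (y q : Site 2) :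
    Real.sqrt 3 / 2 * δ * (triNorm (y - q) : ℝ) ≤ dist (triMeshPoint δ y) (triMeshPoint δ q) := by
  rw [dist_triMeshPoint_eq hδ]
  have := mul_triNorm_le_norm_triEmbed (y - q)
  nlinarith [norm_nonneg (triEmbed (y - q))]

/-- **Junction configuration ⇒ event inclusion.**  Given the data of `junction_dichotomy` inside
the square at mesh `1/N` (free sites `J` are mesh vertices; neighbours of the two black masses lie
in the discrete arcs of `A`, `A'`; neighbours of the wall are within `r₁` of `p`, neighbours of the
frame farther than `r₂`), a configuration WITHOUT an open crossing `A ↔ A'` of the square has a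
closed crossing of the annulus `A(p; r₁, r₂)`. -/
theorem compl_triCrossing_subset_annulus (hN : 2 ≤ N) {a b : ℤ} {w h : ℕ}
    {BL BR W F J : Set (Site 2)}
    (hcover : triStrip a b w h ⊆ BL ∪ BR ∪ W ∪ F ∪ J)
    (hW : Disjoint W (BL ∪ BR ∪ J)) (hF : Disjoint F (BL ∪ BR ∪ J))
    (hBLBR : Disjoint BL BR) (hadjBLBR : ∀ x ∈ BL, ∀ y ∈ BR, ¬ triGraph.Adj x y)
    (hWF : Disjoint W F) (hadjWF : ∀ x ∈ W, ∀ y ∈ F, ¬ triGraph.Adj x y)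
    (hLcol : ∀ z ∈ triStrip a b w h, z 0 = a → z ∈ BL ∪ W ∪ F)
    (hRcol : ∀ z ∈ triStrip a b w h, z 0 = a + w → z ∈ BR ∪ W ∪ F)
    (hBrow : ∀ z ∈ triStrip a b w h, z 1 = b → z ∈ BL ∪ BR ∪ W)
    (hTrow : ∀ z ∈ triStrip a b w h, z 1 = b + h → z ∈ BL ∪ BR ∪ F)
    {A A' : Set ℂ} (hJ : J ⊆ sqV N)
    (hBLarc : ∀ b₁ ∈ BL, ∀ x ∈ J, triGraph.Adj b₁ x → x ∈ triDiscreteArc usq (1 / (N : ℝ)) A)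
    (hBRarc : ∀ b₂ ∈ BR, ∀ y ∈ J, triGraph.Adj y b₂ → y ∈ triDiscreteArc usq (1 / (N : ℝ)) A')
    {p : ℂ} {r₁ r₂ : ℝ}
    (hWnear : ∀ w₁ ∈ W, ∀ x ∈ J, triGraph.Adj w₁ x → ‖triMeshPoint (1 / (N : ℝ)) x - p‖ < r₁)
    (hFfar : ∀ f ∈ F, ∀ y ∈ J, triGraph.Adj y f → r₂ < ‖triMeshPoint (1 / (N : ℝ)) y - p‖) :
    (triCrossing usq (1 / (N : ℝ)) A A')ᶜ ⊆ triAnnulusCrossing false (1 / (N : ℝ)) p r₁ r₂ := by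
  intro ω hω
  rcases junction_dichotomy hcover hW hF hBLBR hadjBLBR hWF hadjWF hLcol hRcol hBrow hTrow ω with
    ⟨b₁, hb₁, b₂, hb₂, x, y, hadj₁, hadj₂, P⟩ | ⟨w₁, hw₁, f₂, hf₂, x, y, hadj₁, hadj₂, Q⟩
  · exfalso
    refine hω ⟨x, hBLarc b₁ hb₁ x P.left_mem.1 hadj₁, y, hBRarc b₂ hb₂ y P.right_mem.1 hadj₂, ?_⟩
    rw [triMeshDomain_sq hN]
    have P' : PathIn triGraph (sqV N ∩ ω) x y := P.mono (Set.inter_subset_inter_left _ hJ)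
    have := siteConnIn_sq_of_pathIn hN P'
    rwa [triMeshDomain_sq hN] at this
  · obtain ⟨q, hq⟩ := Q.exists_walk
    refine ⟨x, y, q, hWnear w₁ hw₁ x Q.left_mem.1 hadj₁, hFfar f₂ hf₂ y Q.right_mem.1 hadj₂,
      fun v hv => ?_⟩
    have := hq v hv
    simp only [Bool.coe_false, iff_false]
    exact this.2

/-- **The annulus bound, as a lower bound on a crossing probability.**  If the complement of a
crossing event lies in the closed-crossing event of an annulus `A(p; r₁, r₂)` with
`1000 δ ≤ r₁`, `2 r₁ ≤ r₂`, then the crossing has probability `≥ 1 − (r₁/r₂)^α`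
(`α` = the exponent of `tri_annulusCrossing_bound_holds`). -/
theorem one_sub_rpow_le_of_subset_annulus {α : ℝ}
    (hα : ∀ (c : Bool) (δ : ℝ) (z : ℂ) (r₁ r₂ : ℝ), 0 < δ → 1000 * δ ≤ r₁ → 2 * r₁ ≤ r₂ →
      (triSitePercolation half).real (triAnnulusCrossing c δ z r₁ r₂) ≤ (r₁ / r₂) ^ α)
    {δ : ℝ} (hδ : 0 < δ) {E : Set (SiteConfig (Site 2))} (hE : MeasurableSet E) {p : ℂ} {r₁ r₂ : ℝ}
    (h1 : 1000 * δ ≤ r₁) (h2 : 2 * r₁ ≤ r₂) (hsub : Eᶜ ⊆ triAnnulusCrossing false δ p r₁ r₂) :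
    1 - (r₁ / r₂) ^ α ≤ (triSitePercolation half).real E := by
  have hc : (triSitePercolation half).real Eᶜ ≤ (r₁ / r₂) ^ α :=
    (measureReal_mono hsub).trans (hα false δ p r₁ r₂ hδ h1 h2)
  rw [probReal_compl_eq_one_sub hE] at hc
  linarith

/-- **Squeeze to `1`.**  A sequence of probabilities bounded below by `1 − (g n)^α` with
`g n → 0` and `α > 0` tends to `1`. -/
theorem tendsto_one_of_ge_one_sub_rpow {α : ℝ} (hα : 0 < α) {P g : ℕ → ℝ}
    (hP1 : ∀ n, P n ≤ 1) (hg : Tendsto g atTop (𝓝 0))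
    (hP : ∀ᶠ n in atTop, 1 - g n ^ α ≤ P n) : Tendsto P atTop (𝓝 1) := by
  have hlow : Tendsto (fun n => 1 - g n ^ α) atTop (𝓝 1) := by
    have h := hg.rpow_const (p := α) (Or.inr hα.le)
    rw [Real.zero_rpow hα.ne'] at h
    simpa using h.const_sub 1
  exact tendsto_of_tendsto_of_tendsto_of_le_of_le' hlow tendsto_const_nhds hP
    (Eventually.of_forall hP1)

end Junction

/-! ## Geometry 1: a junction on the bottom side (flat) -/

section FlatBottom

open MeasureTheory Filter
open scoped Topology

/-- Flat bottom junction at column `c`: the black mass LEFT of the wall (exterior, rows `≤ 0`). -/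
def fbBL (c : ℤ) : Set (Site 2) := {z | z 1 ≤ 0 ∧ z 0 ≤ c - 1}
/-- Flat bottom junction: the black mass RIGHT of the wall. -/
def fbBR (c : ℤ) : Set (Site 2) := {z | z 1 ≤ 0 ∧ c + 1 ≤ z 0}
/-- Flat bottom junction: the white wall (the exterior column below the junction point). -/
def fbW (c : ℤ) : Set (Site 2) := {z | z 1 ≤ 0 ∧ z 0 = c}
/-- Flat bottom junction: the white frame (window sites at lattice distance `≥ L`). -/
def fbF (c L : ℤ) : Set (Site 2) := {z | 1 ≤ z 1 ∧ (z 0 ≤ c - L ∨ c + L ≤ z 0 ∨ L ≤ z 1)}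
/-- Flat bottom junction: the free sites (window sites near the junction). -/
def fbJ (c L : ℤ) : Set (Site 2) := {z | 1 ≤ z 1 ∧ z 1 < L ∧ c - L < z 0 ∧ z 0 < c + L}

variable {c : ℤ} {L : ℕ}

@[simp] theorem mem_fbBL {z : Site 2} : z ∈ fbBL c ↔ z 1 ≤ 0 ∧ z 0 ≤ c - 1 := Iff.rfl
@[simp] theorem mem_fbBR {z : Site 2} : z ∈ fbBR c ↔ z 1 ≤ 0 ∧ c + 1 ≤ z 0 := Iff.rfl
@[simp] theorem mem_fbW {z : Site 2} : z ∈ fbW c ↔ z 1 ≤ 0 ∧ z 0 = c := Iff.rfl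
@[simp] theorem mem_fbF {L : ℤ} {z : Site 2} :
    z ∈ fbF c L ↔ 1 ≤ z 1 ∧ (z 0 ≤ c - L ∨ c + L ≤ z 0 ∨ L ≤ z 1) := Iff.rfl
@[simp] theorem mem_fbJ {L : ℤ} {z : Site 2} :
    z ∈ fbJ c L ↔ 1 ≤ z 1 ∧ z 1 < L ∧ c - L < z 0 ∧ z 0 < c + L := Iff.rfl

/-- A neighbour in `J` of a site of the left mass is a bottom-row site left of the wall. -/
theorem fb_BL_nbr {L : ℤ} {b x : Site 2} (hb : b ∈ fbBL c) (hx : x ∈ fbJ c L)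
    (h : triGraph.Adj b x) : x 1 = 1 ∧ c - L < x 0 ∧ x 0 ≤ c - 1 := by
  rw [mem_fbBL] at hb; rw [mem_fbJ] at hx; rw [triGraph_adj_iff_coord] at h; omega

/-- A neighbour in `J` of a site of the right mass is a bottom-row site right of the wall. -/
theorem fb_BR_nbr {L : ℤ} {b y : Site 2} (hb : b ∈ fbBR c) (hy : y ∈ fbJ c L)
    (h : triGraph.Adj y b) : y 1 = 1 ∧ c ≤ y 0 ∧ y 0 < c + L := by
  rw [mem_fbBR] at hb; rw [mem_fbJ] at hy; rw [triGraph_adj_iff_coord] at h; omega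

/-- A neighbour in `J` of a wall site is one of the two sites above the wall tip `(c, 0)`. -/
theorem fb_W_nbr {L : ℤ} {w x : Site 2} (hw : w ∈ fbW c) (hx : x ∈ fbJ c L)
    (h : triGraph.Adj w x) : triGraph.Adj x ![c, 0] := by
  rw [mem_fbW] at hw; rw [mem_fbJ] at hx; rw [triGraph_adj_iff_coord] at h ⊢
  simp only [Matrix.cons_val_zero, Matrix.cons_val_one, Matrix.cons_val_fin_one]
  omega

/-- A neighbour in `J` of a frame site is at hexagonal distance `≥ L − 1` from the wall tip. -/
theorem fb_F_nbr {L : ℤ} {f y : Site 2} (hf : f ∈ fbF c L) (hy : y ∈ fbJ c L)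
    (h : triGraph.Adj y f) : L - 1 ≤ triNorm (y - ![c, 0]) := by
  rw [mem_fbF] at hf; rw [mem_fbJ] at hy; rw [triGraph_adj_iff_coord] at h
  rw [triNorm_eq_max]
  simp only [Pi.sub_apply, Matrix.cons_val_zero, Matrix.cons_val_one, Matrix.cons_val_fin_one]
  omega

/-- **The flat-bottom junction configuration satisfies the painting hypotheses** and hence the
event inclusion of `compl_triCrossing_subset_annulus`, for any arcs `A, A'` receiving the
neighbours of the two masses and any centre/radii receiving the wall/frame neighbours. -/
theorem fb_compl_subset_annulus {N : ℕ} (hN : 2 ≤ N) (hL : 2 ≤ L) {A A' : Set ℂ}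
    (hJ : fbJ c L ⊆ sqV N)
    (hBLarc : ∀ x : Site 2, x 1 = 1 → c - L < x 0 → x 0 ≤ c - 1 → x ∈ fbJ c L →
      x ∈ triDiscreteArc usq (1 / (N : ℝ)) A)
    (hBRarc : ∀ y : Site 2, y 1 = 1 → c ≤ y 0 → y 0 < c + L → y ∈ fbJ c L →
      y ∈ triDiscreteArc usq (1 / (N : ℝ)) A')
    {p : ℂ} {r₁ r₂ : ℝ}
    (hWnear : ∀ x : Site 2, x ∈ sqV N → triGraph.Adj x ![c, 0] → ‖triMeshPoint (1 / (N : ℝ)) x - p‖ < r₁)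
    (hFfar : ∀ y : Site 2, y ∈ sqV N → (L : ℤ) - 1 ≤ triNorm (y - ![c, 0]) →
      r₂ < ‖triMeshPoint (1 / (N : ℝ)) y - p‖) :
    (triCrossing usq (1 / (N : ℝ)) A A')ᶜ ⊆ triAnnulusCrossing false (1 / (N : ℝ)) p r₁ r₂ := by
  have hL' : (2 : ℤ) ≤ L := by exact_mod_cast hL
  refine compl_triCrossing_subset_annulus hN (a := c - L) (b := -(L : ℤ)) (w := 2 * L) (h := 2 * L)
    (BL := fbBL c) (BR := fbBR c) (W := fbW c) (F := fbF c L) (J := fbJ c L)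
    ?_ ?_ ?_ ?_ ?_ ?_ ?_ ?_ ?_ ?_ ?_ hJ ?_ ?_ ?_ ?_
  · intro z hz
    simp only [mem_triStrip] at hz
    simp only [Set.mem_union, mem_fbBL, mem_fbBR, mem_fbW, mem_fbF, mem_fbJ]
    omega
  · refine Set.disjoint_left.2 fun z hz hz' => ?_
    simp only [Set.mem_union, mem_fbBL, mem_fbBR, mem_fbW, mem_fbJ] at hz hz'
    omega
  · refine Set.disjoint_left.2 fun z hz hz' => ?_
    simp only [Set.mem_union, mem_fbBL, mem_fbBR, mem_fbF, mem_fbJ] at hz hz'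
    omega
  · refine Set.disjoint_left.2 fun z hz hz' => ?_
    simp only [mem_fbBL, mem_fbBR] at hz hz'
    omega
  · intro x hx y hy hxy
    simp only [mem_fbBL, mem_fbBR] at hx hy
    rw [triGraph_adj_iff_coord] at hxy
    omega
  · refine Set.disjoint_left.2 fun z hz hz' => ?_
    simp only [mem_fbW, mem_fbF] at hz hz'
    omega
  · intro x hx y hy hxy
    simp only [mem_fbW, mem_fbF] at hx hy
    rw [triGraph_adj_iff_coord] at hxy
    omega
  · intro z hz h0
    simp only [mem_triStrip] at hz
    simp only [Set.mem_union, mem_fbBL, mem_fbW, mem_fbF]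
    omega
  · intro z hz h0
    simp only [mem_triStrip] at hz
    simp only [Set.mem_union, mem_fbBR, mem_fbW, mem_fbF]
    push_cast at h0
    omega
  · intro z hz h0
    simp only [mem_triStrip] at hz
    simp only [Set.mem_union, mem_fbBL, mem_fbBR, mem_fbW]
    omega
  · intro z hz h0
    simp only [mem_triStrip] at hz
    simp only [Set.mem_union, mem_fbBL, mem_fbBR, mem_fbF]
    push_cast at h0
    omega
  · intro b₁ hb₁ x hx hadj
    obtain ⟨h1, h2, h3⟩ := fb_BL_nbr hb₁ hx hadj
    exact hBLarc x h1 h2 h3 hx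
  · intro b₂ hb₂ y hy hadj
    obtain ⟨h1, h2, h3⟩ := fb_BR_nbr hb₂ hy hadj
    exact hBRarc y h1 h2 h3 hy
  · intro w₁ hw₁ x hx hadj
    exact hWnear x (hJ hx) (fb_W_nbr hw₁ hx hadj)
  · intro f hf y hy hadj
    exact hFfar y (hJ hy) (fb_F_nbr hf hy hadj)

end FlatBottom

end StubShadowingT

end Summit.CriticalPhenomena.CardyFormulaZ2.Theorems

end
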